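import Literature.Probability.RandomPlanarGeometry.WholePlaneLoewnerMarkov
import Literature.Probability.RandomPlanarGeometry.WholePlaneLoewnerBackwardChain
import Mathlib.Analysis.Complex.RemovableSingularity
import HarnessLib

/-!
# The radial Loewner maps of the disc are conformal — via whole-plane chains

Topic `Probability/RandomPlanarGeometry`; theorems only. The conformal-map half of the theory of the
radial Loewner chain in the unit disc (`RadialLoewner.Disc`, LSW/Lawler convention; the file
`RadialLoewnerChain` develops the ODE half and announces the conformal-map half as a sequel) is
obtained here WITHOUT a separate development, from the whole-plane theory already in the tree: by
the interior (radial) Markov property of whole-plane Loewner chains (`WholePlaneLoewnerMarkov`: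
`map_add_eq`, `compl_hull_add_eq`, `image_invCoord_compl_hull`), for a whole-plane chain `C` driven
by `λ` and a base time `b`, the radial chain of the shifted driver `U = (u ↦ -λ(b + u))` is the
conjugate of `C` by the interior coordinate `Ψ_b = 1/g_b`:

  `g^𝔻_u (1/g_b(z)) = 1/g_{b+u}(z)`   (`map_shiftDriver_invCoord`),

so `g^𝔻_u` is a bijection of the radial domain `D_u` onto `𝔻` fixing `0` (`bijOn_map_shiftDriver`),
holomorphic on `D_u` (`differentiableOn_map_shiftDriver`; off `0` as a composite of holomorphic
maps, at `0` by Riemann's removable singularity theorem and the growth `|g_t(z)| → ∞` at `∞`).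
Since EVERY continuous driver `U : [0, ∞) → ℝ` is such a shifted driver (`λ(t) = -U(t⁺)`, base time
`0`; whole-plane chains exist for continuous drivers, `WholePlaneLoewnerChain.exists_unique_holds`),
the statements hold for all continuous `U` (`bijOn_map`, `differentiableOn_map`, `map_zero`):
Lawler (2005), §4.2, Prop. 4.? / LSW (2002), (2.6): "`g_t` is the conformal transformation of `D_t`
onto `𝔻` with `g_t(0) = 0`". (The normalisation `g_t'(0) = eᵗ` is not treated here.)

## References

* G. F. Lawler, *Conformally Invariant Processes in the Plane*, AMS (2005), §4.2 (radial Loewner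
  equation), §4.3 (whole-plane chains, Prop. 4.21). [Lawler2005]
* G. F. Lawler, O. Schramm, W. Werner, *One-arm exponent for critical 2D percolation*, EJP 7
  (2002), §2, (2.5)–(2.6). [LawlerSchrammWernerEJP2002]
-/

noncomputable section

open Set Filter Topology Complex Metric
open scoped NNReal

namespace Literature.Probability.RandomPlanarGeometry

namespace RadialLoewner

namespace Disc

/-! ### The radial map at the origin -/

/-- `g^𝔻_u(0) = 0` for every continuous driver. [cite: Lawler2005, §4.2] -/
theorem map_zero {U : ℝ≥0 → ℝ} (hU : Continuous U) (u : ℝ≥0) : map U u 0 = 0 :=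
  map_eq_of_isSolution hU (isSolution_zero U) (WithTop.coe_lt_top u)

/-! ### The radial maps of a shifted driver, through the whole-plane chain -/

section Shift

variable {lam : ℝ → ℝ}

/-- **The radial map is the conjugate of the whole-plane maps**: `g^𝔻_u(1/g_b(z)) = 1/g_{b+u}(z)`
for `z ∉ K_{b+u}`. [cite: Lawler2005, §4.3] -/
theorem map_shiftDriver_invCoord (C : WholePlaneLoewnerChain lam) (hlam : Continuous lam) {b : ℝ}
    {u : ℝ≥0} {z : ℂ} (hz : z ∉ C.hull (b + u)) :
    map (WholePlaneLoewner.shiftDriver lam b) u (C.map b z)⁻¹ = (C.map (b + u) z)⁻¹ := by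
  rw [C.map_add_eq hlam hz, inv_inv]

/-- A nonzero point of the radial domain at time `u` is the interior coordinate `1/g_b(z)` of a
point `z ∉ K_{b+u}`, namely `z = F_b(1/w)`. [cite: Lawler2005, §4.3] -/
theorem exists_eq_invCoord_of_mem_domain (C : WholePlaneLoewnerChain lam) (hlam : Continuous lam)
    {b : ℝ} {u : ℝ≥0} {w : ℂ} (hw : w ∈ domain (WholePlaneLoewner.shiftDriver lam b) u) (hw0 : w ≠ 0) :
    WholePlaneLoewner.BackwardFlow.invMap lam b w⁻¹ ∉ C.hull (b + u) ∧
      (C.map b (WholePlaneLoewner.BackwardFlow.invMap lam b w⁻¹))⁻¹ = w := by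
  have hw1 : ‖w‖ < 1 := mem_ball_zero_iff.1 (domain_subset _ _ hw)
  obtain ⟨hzb, hzw⟩ := C.exists_invCoord_eq hlam (b := b) hw0 hw1
  refine ⟨?_, hzw⟩
  have : WholePlaneLoewner.BackwardFlow.invMap lam b w⁻¹ ∈ (C.hull (b + u))ᶜ := by
    rw [C.compl_hull_add_eq hlam]
    exact ⟨hzb, by rwa [hzw]⟩
  exact this

/-- **The radial map carries the radial domain into the unit disc.** [cite: Lawler2005, §4.2] -/
theorem mapsTo_map_shiftDriver (C : WholePlaneLoewnerChain lam) (hlam : Continuous lam) (b : ℝ) (u : ℝ≥0) :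
    MapsTo (map (WholePlaneLoewner.shiftDriver lam b) u)
      (domain (WholePlaneLoewner.shiftDriver lam b) u) (ball (0 : ℂ) 1) := by
  intro w hw
  by_cases hw0 : w = 0
  · rw [hw0, map_zero (WholePlaneLoewner.continuous_shiftDriver hlam b)]
    exact mem_ball_self one_pos
  · obtain ⟨hz, hzw⟩ := exists_eq_invCoord_of_mem_domain C hlam hw hw0
    rw [← hzw, map_shiftDriver_invCoord C hlam hz]
    exact mem_ball_zero_iff.2 (C.norm_inv_map_lt_one hz)

/-- **The radial map is injective on the radial domain.** [cite: Lawler2005, §4.2] -/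
theorem injOn_map_shiftDriver (C : WholePlaneLoewnerChain lam) (hlam : Continuous lam) (b : ℝ) (u : ℝ≥0) :
    InjOn (map (WholePlaneLoewner.shiftDriver lam b) u)
      (domain (WholePlaneLoewner.shiftDriver lam b) u) := by
  have hU := WholePlaneLoewner.continuous_shiftDriver hlam b
  intro w hw w' hw' h
  by_cases hw0 : w = 0
  · by_cases hw0' : w' = 0
    · rw [hw0, hw0']
    · obtain ⟨hz', hzw'⟩ := exists_eq_invCoord_of_mem_domain C hlam hw' hw0'
      rw [hw0, map_zero hU, ← hzw', map_shiftDriver_invCoord C hlam hz'] at h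
      exact absurd h.symm (inv_ne_zero (C.map_ne_zero hz'))
  · obtain ⟨hz, hzw⟩ := exists_eq_invCoord_of_mem_domain C hlam hw hw0
    by_cases hw0' : w' = 0
    · rw [hw0', map_zero hU, ← hzw, map_shiftDriver_invCoord C hlam hz] at h
      exact absurd h (inv_ne_zero (C.map_ne_zero hz))
    · obtain ⟨hz', hzw'⟩ := exists_eq_invCoord_of_mem_domain C hlam hw' hw0'
      rw [← hzw, ← hzw', map_shiftDriver_invCoord C hlam hz, map_shiftDriver_invCoord C hlam hz'] at h
      have h' := (C.bijOn_map (b + u)).injOn hz hz' (inv_injective h)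
      rw [← hzw, ← hzw', h']

/-- **The radial map is onto the unit disc.** [cite: Lawler2005, §4.2] -/
theorem surjOn_map_shiftDriver (C : WholePlaneLoewnerChain lam) (hlam : Continuous lam) (b : ℝ) (u : ℝ≥0) :
    SurjOn (map (WholePlaneLoewner.shiftDriver lam b) u)
      (domain (WholePlaneLoewner.shiftDriver lam b) u) (ball (0 : ℂ) 1) := by
  have hU := WholePlaneLoewner.continuous_shiftDriver hlam b
  intro v hv
  by_cases hv0 : v = 0
  · exact ⟨0, zero_mem_domain _ _, by rw [map_zero hU, hv0]⟩
  · obtain ⟨hz, hzv⟩ := C.exists_invCoord_eq hlam (b := b + u) hv0 (mem_ball_zero_iff.1 hv)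
    refine ⟨(C.map b (WholePlaneLoewner.BackwardFlow.invMap lam (b + u) v⁻¹))⁻¹, ?_, ?_⟩
    · exact ((C.compl_hull_add_eq hlam b u).subset hz).2
    · rw [map_shiftDriver_invCoord C hlam hz, hzv]

/-- **The radial Loewner map is a bijection of the radial domain onto the unit disc**
(LSW (2002), (2.6); Lawler (2005), §4.2: "`g_t` is the conformal transformation of `D_t` onto `𝔻`
with `g_t(0) = 0`"), for shifted drivers of whole-plane chains. [cite: Lawler2005, §4.2] -/
theorem bijOn_map_shiftDriver (C : WholePlaneLoewnerChain lam) (hlam : Continuous lam) (b : ℝ) (u : ℝ≥0) :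
    BijOn (map (WholePlaneLoewner.shiftDriver lam b) u)
      (domain (WholePlaneLoewner.shiftDriver lam b) u) (ball (0 : ℂ) 1) :=
  ⟨mapsTo_map_shiftDriver C hlam b u, injOn_map_shiftDriver C hlam b u, surjOn_map_shiftDriver C hlam b u⟩

/-- The whole-plane map `g_t` is holomorphic off the hull. [folklore] -/
theorem _root_.Literature.Probability.RandomPlanarGeometry.WholePlaneLoewnerChain.differentiableOn_map
    (C : WholePlaneLoewnerChain lam) (t : ℝ) : DifferentiableOn ℂ (C.map t) (C.hull t)ᶜ := by
  obtain ⟨φ, hφ⟩ := C.exists_conformalEquiv t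
  exact φ.differentiableOn_coe.congr hφ

/-- **The radial map is holomorphic on the radial domain off the origin**, being there the composite
`w ↦ 1/g_{b+u}(F_b(1/w))` of holomorphic maps. [cite: Lawler2005, §4.2] -/
theorem differentiableOn_map_shiftDriver_diff (C : WholePlaneLoewnerChain lam) (hlam : Continuous lam)
    (b : ℝ) (u : ℝ≥0) :
    DifferentiableOn ℂ (map (WholePlaneLoewner.shiftDriver lam b) u)
      (domain (WholePlaneLoewner.shiftDriver lam b) u \ {0}) := by
  set D := domain (WholePlaneLoewner.shiftDriver lam b) u
  have heq : EqOn (fun w ↦ (C.map (b + u) (WholePlaneLoewner.BackwardFlow.invMap lam b w⁻¹))⁻¹)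
      (map (WholePlaneLoewner.shiftDriver lam b) u) (D \ {0}) := by
    rintro w ⟨hw, hw0⟩
    obtain ⟨hz, hzw⟩ := exists_eq_invCoord_of_mem_domain C hlam hw hw0
    simp only
    rw [← map_shiftDriver_invCoord C hlam hz, hzw]
  refine DifferentiableOn.congr ?_ fun w hw ↦ (heq hw).symm
  have h1 : DifferentiableOn ℂ (fun w : ℂ ↦ w⁻¹) (D \ {0}) :=
    fun w hw ↦ (differentiableAt_inv hw.2).differentiableWithinAt
  have h1m : MapsTo (fun w : ℂ ↦ w⁻¹) (D \ {0}) exteriorDisc := by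
    rintro w ⟨hw, hw0⟩
    rw [mem_exteriorDisc, norm_inv]
    exact (one_lt_inv₀ (norm_pos_iff.2 hw0)).2 (mem_ball_zero_iff.1 (domain_subset _ _ hw))
  have h2 : DifferentiableOn ℂ (WholePlaneLoewner.BackwardFlow.invMap lam b) exteriorDisc :=
    WholePlaneLoewner.BackwardFlow.differentiableOn_invMap hlam b
  have h12 : DifferentiableOn ℂ (fun w : ℂ ↦ WholePlaneLoewner.BackwardFlow.invMap lam b w⁻¹) (D \ {0}) :=
    h2.comp h1 h1m
  have h12m : MapsTo (fun w : ℂ ↦ WholePlaneLoewner.BackwardFlow.invMap lam b w⁻¹) (D \ {0})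
      (C.hull (b + u))ᶜ := by
    rintro w ⟨hw, hw0⟩
    exact (exists_eq_invCoord_of_mem_domain C hlam hw hw0).1
  have h3 : DifferentiableOn ℂ
      (fun w : ℂ ↦ C.map (b + u) (WholePlaneLoewner.BackwardFlow.invMap lam b w⁻¹)) (D \ {0}) :=
    (C.differentiableOn_map (b + u)).comp h12 h12m
  exact h3.inv fun w hw ↦ C.map_ne_zero (h12m hw)

/-- **The whole-plane map tends to infinity at infinity**: `|g_t(z)| → ∞` as `z → ∞` off the hull
(from the normalisation `z / g_t(z) → eᵗ`). [cite: Lawler2005, Prop. 4.21] -/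
theorem _root_.Literature.Probability.RandomPlanarGeometry.WholePlaneLoewnerChain.tendsto_norm_map_atTop
    (C : WholePlaneLoewnerChain lam) (t : ℝ) :
    Tendsto (fun z ↦ ‖C.map t z‖) (cocompact ℂ ⊓ 𝓟 (C.hull t)ᶜ) atTop := by
  set F := cocompact ℂ ⊓ 𝓟 (C.hull t)ᶜ
  have hpos : 0 < Real.exp t + 1 := by positivity
  have h1 : ∀ᶠ z in F, ‖z / C.map t z‖ < Real.exp t + 1 := by
    have hlt : ‖(Real.exp t : ℂ)‖ < Real.exp t + 1 := by
      rw [Complex.norm_real, Real.norm_eq_abs, abs_of_pos (Real.exp_pos t)]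
      linarith
    exact (C.capacity t).norm.eventually (gt_mem_nhds hlt)
  have h2 : ∀ᶠ z in F, z ∈ (C.hull t)ᶜ := mem_inf_of_right (mem_principal_self _)
  have h3 : Tendsto (fun z : ℂ ↦ ‖z‖) F atTop := tendsto_norm_cocompact_atTop.mono_left inf_le_left
  refine tendsto_atTop_mono' F ?_ (h3.atTop_div_const hpos)
  filter_upwards [h1, h2] with z hz1 hz2
  have hne : C.map t z ≠ 0 := C.map_ne_zero hz2
  have hq : ‖z‖ / ‖C.map t z‖ < Real.exp t + 1 := by rwa [norm_div] at hz1
  rw [div_lt_iff₀ (norm_pos_iff.2 hne)] at hq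
  rw [div_le_iff₀ hpos]
  linarith [mul_comm (Real.exp t + 1) ‖C.map t z‖]

/-- As `w → 0` inside the radial domain, the point `F_b(1/w)` goes to infinity off `K_{b+u}`.
[cite: Lawler2005, Prop. 4.21] -/
theorem tendsto_invMap_inv_cocompact (C : WholePlaneLoewnerChain lam) (hlam : Continuous lam)
    (b : ℝ) (u : ℝ≥0) :
    Tendsto (fun w : ℂ ↦ WholePlaneLoewner.BackwardFlow.invMap lam b w⁻¹)
      (𝓝[domain (WholePlaneLoewner.shiftDriver lam b) u \ {0}] 0)
      (cocompact ℂ ⊓ 𝓟 (C.hull (b + u))ᶜ) := by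
  set D := domain (WholePlaneLoewner.shiftDriver lam b) u
  refine tendsto_inf.2 ⟨?_, tendsto_principal.2 ?_⟩
  · -- norm bound `‖F_b(1/w)‖ ≥ e^b e^{-6} ‖1/w‖` once `‖1/w‖ ≥ 2`
    refine tendsto_cocompact_of_tendsto_dist_comp_atTop (0 : ℂ) ?_
    simp only [dist_zero_right]
    have hinv : Tendsto (fun w : ℂ ↦ ‖w⁻¹‖) (𝓝[D \ {0}] 0) atTop :=
      tendsto_norm_inv_nhdsNE_zero_atTop.mono_left (nhdsWithin_mono _ fun w hw ↦ hw.2)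
    have hpos : 0 < Real.exp b * Real.exp (-6) := by positivity
    refine tendsto_atTop_mono' _ ?_ (hinv.const_mul_atTop hpos)
    filter_upwards [hinv.eventually_ge_atTop 2] with w hw
    have hw1 : 1 < ‖w⁻¹‖ := by linarith
    have h1 := WholePlaneLoewner.BackwardFlow.le_norm_invMap hlam (t := b) hw1
    have h2 : WholePlaneLoewner.BackwardFlow.errConst w⁻¹ ≤ 6 := by
      rw [← WholePlaneLoewner.BackwardFlow.errConst_two]
      exact WholePlaneLoewner.BackwardFlow.errConst_anti (by norm_num) (by simpa using hw)
    have h3 : Real.exp (-6) ≤ Real.exp (-WholePlaneLoewner.BackwardFlow.errConst w⁻¹) :=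
      Real.exp_le_exp.2 (by linarith)
    calc Real.exp b * Real.exp (-6) * ‖w⁻¹‖
        ≤ Real.exp b * ‖w⁻¹‖ * Real.exp (-WholePlaneLoewner.BackwardFlow.errConst w⁻¹) := by
          rw [mul_right_comm]
          exact mul_le_mul_of_nonneg_left h3 (by positivity)
      _ ≤ ‖WholePlaneLoewner.BackwardFlow.invMap lam b w⁻¹‖ := h1
  · refine eventually_nhdsWithin_of_forall fun w hw ↦ ?_
    exact (exists_eq_invCoord_of_mem_domain C hlam hw.1 hw.2).1

/-- **The radial map is continuous at the origin** (value `0`): as `w → 0`,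
`g^𝔻_u(w) = 1/g_{b+u}(F_b(1/w)) → 0` because `F_b(1/w) → ∞` and `|g_{b+u}| → ∞` at infinity.
[cite: Lawler2005, §4.2] -/
theorem continuousAt_map_shiftDriver_zero (C : WholePlaneLoewnerChain lam) (hlam : Continuous lam)
    (b : ℝ) (u : ℝ≥0) :
    ContinuousAt (map (WholePlaneLoewner.shiftDriver lam b) u) 0 := by
  set U := WholePlaneLoewner.shiftDriver lam b
  set D := domain U u
  have hU : Continuous U := WholePlaneLoewner.continuous_shiftDriver hlam b
  have hD : D ∈ 𝓝 (0 : ℂ) := (isOpen_domain hU u).mem_nhds (zero_mem_domain U u)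
  rw [← continuousWithinAt_compl_self, ContinuousWithinAt, map_zero hU,
    nhdsWithin_restrict'' _ (mem_nhdsWithin_of_mem_nhds hD), ← sdiff_eq_compl_inter]
  have heq : ∀ᶠ w in 𝓝[D \ {0}] (0 : ℂ),
      (C.map (b + u) (WholePlaneLoewner.BackwardFlow.invMap lam b w⁻¹))⁻¹ = map U u w := by
    refine eventually_nhdsWithin_of_forall fun w hw ↦ ?_
    obtain ⟨hz, hzw⟩ := exists_eq_invCoord_of_mem_domain C hlam hw.1 hw.2
    rw [← map_shiftDriver_invCoord C hlam hz, hzw]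
  refine Tendsto.congr' heq ?_
  rw [tendsto_zero_iff_norm_tendsto_zero]
  simp only [norm_inv]
  exact ((C.tendsto_norm_map_atTop (b + u)).comp (tendsto_invMap_inv_cocompact C hlam b u)).inv_tendsto_atTop

/-- **The radial Loewner map is holomorphic on the radial domain** (Riemann's removable
singularity theorem at the origin). [cite: Lawler2005, §4.2] -/
theorem differentiableOn_map_shiftDriver (C : WholePlaneLoewnerChain lam) (hlam : Continuous lam)
    (b : ℝ) (u : ℝ≥0) :
    DifferentiableOn ℂ (map (WholePlaneLoewner.shiftDriver lam b) u)
      (domain (WholePlaneLoewner.shiftDriver lam b) u) := by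
  have hU : Continuous (WholePlaneLoewner.shiftDriver lam b) :=
    WholePlaneLoewner.continuous_shiftDriver hlam b
  have hD : domain (WholePlaneLoewner.shiftDriver lam b) u ∈ 𝓝 (0 : ℂ) :=
    (isOpen_domain hU u).mem_nhds (zero_mem_domain _ u)
  exact (Complex.differentiableOn_compl_singleton_and_continuousAt_iff hD).1
    ⟨differentiableOn_map_shiftDriver_diff C hlam b u, continuousAt_map_shiftDriver_zero C hlam b u⟩

end Shift

/-! ### Every continuous driver is a shifted driver: the statements for all continuous `U` -/

section Continuous

variable {U : ℝ≥0 → ℝ}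

/-- **Realising a radial driver inside a whole-plane chain**: for continuous `U`, the driving angle
`λ(t) = -U(t⁺)` is continuous, its shifted driver at base time `0` is `U`, and a whole-plane
Loewner chain driven by `λ` exists (`WholePlaneLoewnerChain.exists_unique_holds`).
[cite: Lawler2005, Prop. 4.21] -/
theorem exists_wholePlaneLoewnerChain_shiftDriver_eq (hU : Continuous U) :
    ∃ lam : ℝ → ℝ, Continuous lam ∧ WholePlaneLoewner.shiftDriver lam 0 = U ∧
      Nonempty (WholePlaneLoewnerChain lam) := by
  refine ⟨fun t ↦ -U t.toNNReal, (hU.comp continuous_real_toNNReal).neg, ?_, ?_⟩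
  · funext u
    simp [WholePlaneLoewner.shiftDriver_apply]
  · exact (WholePlaneLoewnerChain.exists_unique_holds _ (hU.comp continuous_real_toNNReal).neg).1

/-- **The radial Loewner map is a bijection of the radial domain onto the unit disc**, for every
continuous driver (LSW (2002), (2.6); Lawler (2005), §4.2: "`g_t` is the conformal transformation
of `D_t` onto `𝔻` with `g_t(0) = 0`"). [cite: Lawler2005, §4.2] -/
theorem bijOn_map (hU : Continuous U) (u : ℝ≥0) : BijOn (map U u) (domain U u) (ball (0 : ℂ) 1) := by
  obtain ⟨lam, hlam, hshift, ⟨C⟩⟩ := exists_wholePlaneLoewnerChain_shiftDriver_eq hU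
  rw [← hshift]
  exact bijOn_map_shiftDriver C hlam 0 u

/-- **The radial Loewner map is holomorphic on the radial domain**, for every continuous driver.
[cite: Lawler2005, §4.2] -/
theorem differentiableOn_map (hU : Continuous U) (u : ℝ≥0) :
    DifferentiableOn ℂ (map U u) (domain U u) := by
  obtain ⟨lam, hlam, hshift, ⟨C⟩⟩ := exists_wholePlaneLoewnerChain_shiftDriver_eq hU
  rw [← hshift]
  exact differentiableOn_map_shiftDriver C hlam 0 u

/-- The radial Loewner map is continuous on the radial domain. [cite: Lawler2005, §4.2] -/
theorem continuousOn_map (hU : Continuous U) (u : ℝ≥0) : ContinuousOn (map U u) (domain U u) :=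
  (differentiableOn_map hU u).continuousOn

end Continuous

end Disc

end RadialLoewner

end Literature.Probability.RandomPlanarGeometry
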